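import Literature.IUT.HodgeArakelov.CohomologyLimitKummer
import Literature.IUT.HodgeArakelov.CohomologyLimitRestriction

/-!
# The Kummer map into the cohomology limit commutes with restriction `lim_K H¹(H ⊓ K, A') → lim_K H¹(D ⊓ K, A')`
# ([IUTchII] Cor. 1.12 (c): "`M^×_TM(Π) ↪ lim_J H¹(J, (l·Δ_Θ)(Π))`, hence … into `lim_J H¹(Π_Ÿ(Π)|_J, (l·Δ_Θ)(Π))`")

Proof-only companion (abc-iut cell, D-0067 wave 4, seat abc-iut-w4-d007, layer L6; GAP-LEDGER G-w4d019-1 /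
SUBDAG-IUTchII-Cor-112) of `CohomologyLimitKummer.lean` (abc-iut-w4-d007: the Kummer map
`h1LimKummer c hA hfi : A →* Multiplicative (h1Lim φ A' H ⊥)`) and of abc-iut-L6-t1's
`CohomologyLimitRestriction.lean` (`h1LimRestrict φ A' hDH J : h1Lim φ A' H J →+ h1Lim φ A' D J`, `D ≤ H`).
S. Mochizuki, *Inter-universal Teichmüller theory II*, Cor. 1.12 (c) p. 56: "one has a natural inclusion
`M^×_TM(Π) ↪ lim_J H¹(J, (l·Δ_Θ)(Π))`, hence a natural inclusion of `M^×_TM(Π)` into the inductive limit of the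
first line [`lim_J H¹(Π_Ÿ(Π)|_J, (l·Δ_Θ)(Π))`]" [cite: Mochizuki2012, Cor 1.12 p.56] — the second inclusion is
the first followed by the restriction of the limits (`ThetaEvaluation.inclHd` of `ConstantMultipleRigidity.lean`).

PROVED (no definitions, no hypotheses beyond the data of the two files):
* `gmodRestrict_kummerGmod` — level-wise: restricting the level-`K` Kummer class from `H ⊓ K` to `D ⊓ K` gives the
  level-`K` Kummer class for `D` (same cocycle);
* `h1LimRestrict_h1LimKummer` — **`res_D ∘ κ_H = κ_D`**: the Kummer map into `lim_K H¹(H ⊓ K, A')` followed by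
  the restriction to `D ≤ H` IS the Kummer map into `lim_K H¹(D ⊓ K, A')` (so abc-iut-w4-d043's model datum
  `MxTM := res_D (κ(𝒪^×))` is again a Kummer image, and the two "natural inclusions" of Cor. 1.12 (c) are
  compatible);
* `h1LimKummer_injective_of_restrict` — consequently injectivity of `κ_D` implies injectivity of `κ_H` (at the
  model both hold: `CohomologyLimitKummerMLF` / `…Galois`);
* `map_h1LimRestrict_map_h1LimKummer` — the restriction carries the Kummer image of a submonoid for `H` onto its
  Kummer image for `D`.
Claim key of the interface `Mochizuki2012` (D-0012, disputed); classical Kummer theory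
([cite: NeukirchSchmidtWingberg2008, I §5]); nothing here bears on [IUTchIII] Cor. 3.12; typed ≠ proved.
-/

namespace Literature.IUT.HodgeArakelov

open Literature.AnabelianGeometry.EtaleTheta CohomologySystemOfContH1

noncomputable section

namespace CohomologySystemOfContH1

variable {P : TopGroup.{0}} {G' : Type} [Group G'] [TopologicalSpace G'] [IsTopologicalGroup G']
  (φ : P →* G') (A' : Subgroup G') [A'.Normal] [IsMulCommutative A'] {H D : Subgroup P} (hDH : D ≤ H)
  {A : Type} [CommGroup A] [MulDistribMulAction P A] [TopologicalSpace A] [RootableBy A ℕ]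
  (c : CyclotomeCoefficients φ A' A)
  (hA : ∀ b : A, IsOpen (MulAction.stabilizer P b : Set P))
  (hfi : ∀ b : A, (MulAction.stabilizer P b).FiniteIndex)

omit [TopologicalSpace A] [RootableBy A ℕ] in
include hDH in
/-- If `H ⊓ K` fixes `b` and `D ≤ H`, then `D ⊓ K` fixes `b`. [cite: NeukirchSchmidtWingberg2008, I §5] -/
theorem mem_fixedPoints_inf_of_le_left (i : Idx (P := P) ⊥) {b : A}
    (hb : b ∈ MulAction.fixedPoints ↥(H ⊓ i.K) A) : b ∈ MulAction.fixedPoints ↥(D ⊓ i.K) A :=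
  fun h => hb ⟨h.1, inf_le_inf_right i.K hDH h.2⟩

/-- **Level-wise**: the restriction `H¹(H ⊓ K, A') → H¹(D ⊓ K, A')` carries the Kummer class of `b` for `H` to its
Kummer class for `D` (the same continuous cocycle, restricted). [cite: Mochizuki2012, Cor 1.12 p.56] -/
theorem gmodRestrict_kummerGmod (i : Idx (P := P) ⊥) (b : A) (hbH : b ∈ MulAction.fixedPoints ↥(H ⊓ i.K) A)
    (hbD : b ∈ MulAction.fixedPoints ↥(D ⊓ i.K) A) :
    gmodRestrict φ A' hDH ⊥ i (kummerGmod φ A' H c hA i b hbH) = kummerGmod φ A' D c hA i b hbD := by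
  rw [kummerGmod_eq, kummerGmod_eq]
  rfl

/-- **`res_D ∘ κ_H = κ_D`** on the bare functions. [cite: Mochizuki2012, Cor 1.12 p.56] -/
theorem h1LimRestrict_h1LimKummerFun (b : A) :
    h1LimRestrict φ A' hDH ⊥ (h1LimKummerFun φ A' H c hA hfi b) = h1LimKummerFun φ A' D c hA hfi b := by
  rw [h1LimKummerFun, h1LimRestrict_of,
    gmodRestrict_kummerGmod φ A' hDH c hA _ b _ (mem_fixedPoints_stabIdx D hA hfi b)]
  rfl

/-- **The Kummer map commutes with restriction of the limits**: for `D ≤ H ≤ Π`,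
`h1LimRestrict (κ_H b) = κ_D b` — the second "natural inclusion" of Cor. 1.12 (c) (`M^×_TM(Π)` into
`lim_J H¹(Π_Ÿ(Π)|_J, (l·Δ_Θ)(Π))`) is the first one (into `lim_J H¹(J, (l·Δ_Θ)(Π))`, `H = Π`) followed by the
restriction to `D = Π_Ÿ(Π)`. [cite: Mochizuki2012, Cor 1.12 p.56] -/
theorem h1LimRestrict_h1LimKummer (b : A) :
    h1LimRestrict φ A' hDH ⊥ (Multiplicative.toAdd (h1LimKummer φ A' H c hA hfi b)) =
      Multiplicative.toAdd (h1LimKummer φ A' D c hA hfi b) :=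
  h1LimRestrict_h1LimKummerFun φ A' hDH c hA hfi b

/-- The same, multiplicatively: `toMultiplicative res_D ∘ κ_H = κ_D` as monoid homomorphisms.
[cite: Mochizuki2012, Cor 1.12 p.56] -/
theorem toMultiplicative_h1LimRestrict_comp_h1LimKummer :
    (AddMonoidHom.toMultiplicative (h1LimRestrict φ A' hDH ⊥)).comp (h1LimKummer φ A' H c hA hfi) =
      h1LimKummer φ A' D c hA hfi :=
  MonoidHom.ext fun b => congrArg Multiplicative.ofAdd (h1LimRestrict_h1LimKummer φ A' hDH c hA hfi b)

include hDH in
/-- **Injectivity transfers up**: if the Kummer map into `lim_K H¹(D ⊓ K, A')` is injective, so is the Kummer map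
into `lim_K H¹(H ⊓ K, A')` for every `H ≥ D`. [cite: Mochizuki2012, Cor 1.12 p.56] -/
theorem h1LimKummer_injective_of_restrict (hinj : Function.Injective (h1LimKummer φ A' D c hA hfi)) :
    Function.Injective (h1LimKummer φ A' H c hA hfi) := by
  rw [← toMultiplicative_h1LimRestrict_comp_h1LimKummer φ A' hDH c hA hfi, MonoidHom.coe_comp] at hinj
  exact Function.Injective.of_comp hinj

/-- The restriction maps the Kummer image (for `H`) of a submonoid `O ≤ A` ONTO its Kummer image for `D`:
`res_D (κ_H(O)) = κ_D(O)` — e.g. `res_{Π_Ÿ}(M^×_TM) =` the Kummer image of `𝒪^×` in the first line.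
[cite: Mochizuki2012, Cor 1.12 p.56] -/
theorem map_h1LimRestrict_map_h1LimKummer (O : Submonoid A) :
    (O.map (h1LimKummer φ A' H c hA hfi)).map (AddMonoidHom.toMultiplicative (h1LimRestrict φ A' hDH ⊥)) =
      O.map (h1LimKummer φ A' D c hA hfi) := by
  rw [Submonoid.map_map, toMultiplicative_h1LimRestrict_comp_h1LimKummer]

end CohomologySystemOfContH1

end

end Literature.IUT.HodgeArakelov
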